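import Summits.FinalStateConjecture.FinalStateConjecture.Theses.ZeroEnergyKerrOrBomb
import Summits.FinalStateConjecture.FinalStateConjecture.Theorems.ZeroEnergyKerrOrBombZeroEnergyRigidityRegularCase
import Summits.FinalStateConjecture.FinalStateConjecture.Theorems.ZeroEnergyKerrOrBombZeroEnergyRigidityStubDocIsometryTransfer

/-!
# Crux `ZeroEnergyRigidity` (stmt-FinalStateConjecture-10690) — line `global-horizon-killing-field`
# (lead gen 2, prover-line-stmt-FinalStateConjecture-10690-2): the registered skeleton, re-materialised

Same stub set as the gen-1 registration (skeleton sha 1b12303a…, 2026-08-16T07:01:53Z):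

* S1 `stub_regularRepresentation` — the `I⁺`-regular vacuum RE-PRESENTATION of the d.o.c. with a
  complete, `T`-commuting, horizon-generating Killing field (`κ ≠ 0`); carries ALL the
  non-classical content of the typed crux (it is equivalent to the crux modulo the four printed
  theorems below; see `Cruxes/ZeroEnergyRigidity/NOTES.md`);
* four Literature named facts (debts, worked by literature-provers):
  `SudarskyWald1993_staticity`, `ChruscielGalloway2010_docStaticUniqueness`,
  `BeigChrusciel1997_axisymmetricCombination`, `ChruscielCostaHeusler2012_axisymmetricUniqueness`.

Everything else of the line is LANDED and imported: the regular-case dichotomy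
`RegularCase.stub_kerrConclusion_of_regular` (p89982; it packages S2c p85668, S3c p85291, S4 p80091)
and the d.o.c. transport `DocIsometryTransfer.stub_docIsometryTransfer` (S5, p79890).
`ZeroEnergyRigidity_of` concludes the route decl BY NAME; `sorry` occurs only in the five `stub_*`.
Hypotheses h5 (`T ≠ 0` on the d.o.c.) and h6 (no compactly imprisoned zero-energy ray) of the
typed crux are not used: both are theorems under h4 (`Negative.zeroEnergyRigidity_iff_core`).
-/

noncomputable section

-- `Summit.FinalStateConjecture.FinalStateConjecture.…`: summit = problem name (single-conjunct summit, D-0017).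
set_option linter.dupNamespace false

namespace Summit.FinalStateConjecture.FinalStateConjecture.Theorems.ZeroEnergyRigidity.GlobalHorizonKillingField

open Set Function Literature.Geometry.Lorentzian
open scoped Manifold ContDiff Topology
open Summit.FinalStateConjecture.FinalStateConjecture.Theses.ZeroEnergyKerrOrBomb (ZeroEnergyRigidity)

/-! ## The five stubs (`sorry` lives only here; statements over tree vocabulary only) -/

/-- **Stub S1 · regularRepresentation (HARDEST; held by the lead).**  A vacuum presentation with
connected non-degenerate horizon (global h3-witness) and globally hyperbolic carrier admits an
`I⁺`-REGULAR vacuum re-presentation `𝓑'` (Chruściel–Costa 2008, Def. 1.1) with connected horizon,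
carrying a Killing field `K'` which is COMPLETE, COMMUTES with the stationary field `T'`, is nowhere
zero on and tangent to `𝓔⁺'` and satisfies `∇_{K'} K' = κ K'` there with `κ ≠ 0`, and whose d.o.c.
(open submanifold, restricted metric) is carried by a smooth injective isometric immersion `Θ` onto
`𝓑.doc`.  Registered signature, verbatim. -/
theorem stub_regularRepresentation :
    ∀ (𝓑 : StationaryAFBlackHole.{0}) [𝓑.metric.HasLeviCivita],
      𝓑.metric.toPseudoRiemannianMetric.IsRicciFlat → IsConnected 𝓑.horizon →
      𝓑.toSpacetime.IsNonDegenerateHorizon 𝓑.Mext →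
      𝓑.metric.IsGloballyHyperbolic 𝓑.timeOrientation →
        ∃ (𝓑' : StationaryAFBlackHole.{0}) (_ : 𝓑'.metric.HasLeviCivita),
          𝓑'.metric.toPseudoRiemannianMetric.IsRicciFlat ∧ 𝓑'.IsIPlusRegular ∧
          IsConnected 𝓑'.horizon ∧
          (∃ K' : Π x : 𝓑'.carrier, TangentSpace (𝓡 4) x,
            𝓑'.metric.IsKillingField K' ∧ IsCompleteVectorField K' ∧
            (∀ x, VectorField.mlieBracket (𝓡 4) 𝓑'.killing K' x = 0) ∧
            (∀ p ∈ 𝓑'.horizon, K' p ≠ 0) ∧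
            (∀ γ : ℝ → 𝓑'.carrier, IsMIntegralCurve γ K' → γ 0 ∈ 𝓑'.horizon →
              ∀ t, γ t ∈ 𝓑'.horizon) ∧
            ∃ κ : ℝ, κ ≠ 0 ∧ ∀ p ∈ 𝓑'.horizon, 𝓑'.metric.leviCivita K' p (K' p) = κ • K' p) ∧
          ∃ Θ : 𝓑'.docOpens LorentzianMetric.isOpen_chronologicalFuture_holds_of_boundaryless
              LorentzianMetric.isOpen_chronologicalPast_holds_of_boundaryless → 𝓑.carrier,
            Function.Injective Θ ∧ Set.range Θ = 𝓑.doc ∧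
            PseudoRiemannianMetric.IsIsometricImmersion
              (𝓑'.metric.restrict PseudoRiemannianMetric.contMDiff_restrict_holds
                (𝓑'.docOpens LorentzianMetric.isOpen_chronologicalFuture_holds_of_boundaryless
                  LorentzianMetric.isOpen_chronologicalPast_holds_of_boundaryless)).toPseudoRiemannianMetric
              𝓑.metric.toPseudoRiemannianMetric Θ := by
  sorry

/-- **Stub · sudarskyWaldStaticity** (Literature named fact; Sudarsky–Wald 1993 + Chruściel–Wald
1994: a non-rotating `I⁺`-regular vacuum hole is static on its d.o.c.). -/
theorem stub_sudarskyWaldStaticity : SudarskyWald1993_staticity := by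
  sorry

/-- **Stub · docStaticUniqueness** (Literature named fact; Chruściel–Galloway 2010 /
Chruściel–Costa–Heusler 2012, Thm. 3.1: static `I⁺`-regular vacuum d.o.c. is Schwarzschild). -/
theorem stub_docStaticUniqueness : ChruscielGalloway2010_docStaticUniqueness := by
  sorry

/-- **Stub · beigChruscielCombination** (Literature named fact; Beig–Chruściel 1997, Thm. 1.2:
a second complete commuting Killing field combines with `T` to a `2π`-periodic axial field). -/
theorem stub_beigChruscielCombination : BeigChrusciel1997_axisymmetricCombination.{0} := by
  sorry

/-- **Stub · cchAxisymmetricUniqueness** (Literature named fact; Chruściel–Costa–Heusler 2012,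
Thm. 3.2: `I⁺`-regular stationary axisymmetric vacuum hole with connected non-degenerate horizon
is Kerr — no analyticity). -/
theorem stub_cchAxisymmetricUniqueness : ChruscielCostaHeusler2012_axisymmetricUniqueness.{0} := by
  sorry

/-! ## Composition (kernel-checked, no `sorry` outside the stubs) -/

/-- **The skeleton theorem**: the five stubs imply the crux `ZeroEnergyRigidity` BY NAME — S1
re-presents, the landed regular-case dichotomy (`RegularCase.stub_kerrConclusion_of_regular`, fed
with the four named facts) gives the Kerr chart conclusion for the re-presentation, and the landed
transport S5 (`DocIsometryTransfer.stub_docIsometryTransfer`) carries it back along `Θ`.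
Hypotheses h5 and h6 of the typed crux are not used. -/
theorem ZeroEnergyRigidity_of : ZeroEnergyRigidity := by
  intro 𝓑 _ _ h1 h2 h3 h4 _h5 _h6
  obtain ⟨𝓑', inst', h1', hreg', hconn', hK', hΘ⟩ := stub_regularRepresentation 𝓑 h1 h2 h3 h4
  haveI := inst'
  exact DocIsometryTransfer.stub_docIsometryTransfer 𝓑 𝓑' hΘ
    (RegularCase.stub_kerrConclusion_of_regular stub_sudarskyWaldStaticity stub_docStaticUniqueness
      stub_cchAxisymmetricUniqueness stub_beigChruscielCombination 𝓑' h1' hreg' hconn' hK')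

end Summit.FinalStateConjecture.FinalStateConjecture.Theorems.ZeroEnergyRigidity.GlobalHorizonKillingField

end
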